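import Mathlib.RepresentationTheory.Irreducible
import HarnessLib

/-!
# Irreducibility is invariant under character twists, equivariant equivalences and surjective pull-backs

Topic `RepresentationTheory`; namespace `Representation` (dot notation on Mathlib's `Representation.IsIrreducible :=
IsSimpleOrder (Subrepresentation ρ)`).  Theorems only (no definition, no record, no named fact, no `sorry`).

For representations `ρ` of `G` on `V` and `ρ'` of `G'` on `V'` over a field `k`, a SURJECTIVE homomorphism
`φ : G →* G'`, a linear equivalence `e : V ≃ₗ[k] V'` and scalars `c : G → kˣ` with the TWISTED intertwining law
`e (ρ g v) = c g • ρ' (φ g) (e v)`: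

* `exists_orderIso_subrepresentation_of_twist` — `W ↦ e(W)` is an order isomorphism from the `ρ`-stable subspaces of
  `V` onto the `ρ'`-stable subspaces of `V'` (a subspace is stable under `ρ' g'` iff it is stable under the scalar
  multiple `c g • ρ' g'`);
* `isIrreducible_iff_of_twist_equivariant` — hence `ρ` is irreducible iff `ρ'` is: **irreducibility is insensitive to
  twisting by a character** (Bump 1997, Exercise 2.2.2 / §4.2: `π ⊗ χ` is irreducible iff `π` is) and is transported
  along equivariant isomorphisms;
* `isIrreducible_iff_of_equivariant` (`c = 1`), `isIrreducible_comp_iff_of_surjective` /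
  `IsIrreducible.comp_of_surjective` (pull-back along a surjection: the stable subspaces are the same),
  `isIrreducible_iff_of_forall_eq_units_smul` (two actions of one group on one space differing by unit scalars).

Written for the Hodge/COR-CM transposition lane (item (vi)): the Weil `χ`-coinvariant carrier `ω(μ, ε, χ)` of
[Liu2021, Def. 4.11] is identified with the coinvariants of a reference section only UP TO A CHARACTER TWIST
(`GelbartRogawski1991/UnitaryDualPairWeilCoinvariantsReference.lean`, `exists_weilCoinv_equiv_reference`), and its
`𝔾(𝔸_F^∞)`-action is pulled back along a group isomorphism; these lemmas move irreducibility across both steps.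

## References
* D. Bump, *Automorphic forms and representations*, Cambridge Stud. Adv. Math. 55 (1997), §2.2 (twisting by a
  character), §4.2 (smooth representations; twists `π ⊗ χ`) [Bump1997].
* Mathlib `Mathlib.RepresentationTheory.Irreducible` (`Representation.IsIrreducible`), `…Subrepresentation`.
-/

namespace Representation

variable {k G G' V V' : Type*} [Field k] [Monoid G] [Monoid G'] [AddCommGroup V] [Module k V]
  [AddCommGroup V'] [Module k V']

/-- **Stable subspaces correspond under a twisted-equivariant linear equivalence over a surjective homomorphism.**
For `φ : G →* G'` onto, `e : V ≃ₗ V'` and units `c g` with `e (ρ g v) = c g • ρ' (φ g) (e v)`, the map `W ↦ e(W)`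
is an order isomorphism `Subrepresentation ρ ≃o Subrepresentation ρ'` (inverse `W' ↦ e⁻¹(W')`).
[cite: Bump1997, §4.2 (twisting a representation by a character)] -/
theorem exists_orderIso_subrepresentation_of_twist (ρ : Representation k G V) (ρ' : Representation k G' V')
    (φ : G →* G') (hφ : Function.Surjective φ) (e : V ≃ₗ[k] V') (c : G → kˣ)
    (he : ∀ g v, e (ρ g v) = (c g : k) • ρ' (φ g) (e v)) :
    ∃ Φ : Subrepresentation ρ ≃o Subrepresentation ρ',
      ∀ W : Subrepresentation ρ, (Φ W).toSubmodule = W.toSubmodule.map (e : V →ₗ[k] V') := by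
  -- stability of `e(W)`: `ρ' (φ g) (e w) = e ((c g)⁻¹ • ρ g w)`
  have hfwd : ∀ (W : Subrepresentation ρ) (g' : G') ⦃v' : V'⦄,
      v' ∈ W.toSubmodule.map (e : V →ₗ[k] V') → ρ' g' v' ∈ W.toSubmodule.map (e : V →ₗ[k] V') := by
    rintro W g' v' ⟨w, hw, rfl⟩
    obtain ⟨g, rfl⟩ := hφ g'
    refine ⟨((c g)⁻¹ : kˣ) • ρ g w, W.toSubmodule.smul_mem _ (W.apply_mem_toSubmodule g hw), ?_⟩
    rw [LinearEquiv.coe_coe, Units.smul_def, map_smul, he g w, smul_smul, Units.inv_mul, one_smul]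
  -- stability of `e⁻¹(W')`
  have hbwd : ∀ (W' : Subrepresentation ρ') (g : G) ⦃v : V⦄,
      v ∈ W'.toSubmodule.comap (e : V →ₗ[k] V') → ρ g v ∈ W'.toSubmodule.comap (e : V →ₗ[k] V') := by
    intro W' g v hv
    simp only [Submodule.mem_comap, LinearEquiv.coe_coe] at hv ⊢
    rw [he g v]
    exact W'.toSubmodule.smul_mem _ (W'.apply_mem_toSubmodule (φ g) hv)
  refine ⟨{ toFun := fun W => ⟨W.toSubmodule.map (e : V →ₗ[k] V'), hfwd W⟩
            invFun := fun W' => ⟨W'.toSubmodule.comap (e : V →ₗ[k] V'), hbwd W'⟩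
            left_inv := fun W => Subrepresentation.toSubmodule_injective
              (Submodule.comap_map_eq_of_injective e.injective _)
            right_inv := fun W' => Subrepresentation.toSubmodule_injective
              (Submodule.map_comap_eq_of_surjective e.surjective _)
            map_rel_iff' := fun {W₁ W₂} => ?_ }, fun W => rfl⟩
  change Submodule.map (e : V →ₗ[k] V') W₁.toSubmodule ≤ Submodule.map (e : V →ₗ[k] V') W₂.toSubmodule ↔
    W₁.toSubmodule ≤ W₂.toSubmodule
  exact Submodule.map_le_map_iff_of_injective e.injective _ _

/-- **Irreducibility is invariant under a twisted-equivariant linear equivalence over a surjective homomorphism**: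
with `φ` onto, `e : V ≃ₗ V'` and `e (ρ g v) = c g • ρ' (φ g) (e v)` for units `c g`, `ρ` is irreducible iff `ρ'` is.
In particular **twisting by a character does not affect irreducibility**. [cite: Bump1997, §4.2 (twisting a representation by a character)] -/
theorem isIrreducible_iff_of_twist_equivariant (ρ : Representation k G V) (ρ' : Representation k G' V')
    (φ : G →* G') (hφ : Function.Surjective φ) (e : V ≃ₗ[k] V') (c : G → kˣ)
    (he : ∀ g v, e (ρ g v) = (c g : k) • ρ' (φ g) (e v)) : ρ.IsIrreducible ↔ ρ'.IsIrreducible := by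
  obtain ⟨Φ, -⟩ := exists_orderIso_subrepresentation_of_twist ρ ρ' φ hφ e c he
  exact Φ.isSimpleOrder_iff

/-- **Irreducibility is invariant under an equivariant linear equivalence over a surjective homomorphism**
(`e (ρ g v) = ρ' (φ g) (e v)`). [cite: Bump1997, §4.2 (twisting a representation by a character)] -/
theorem isIrreducible_iff_of_equivariant (ρ : Representation k G V) (ρ' : Representation k G' V')
    (φ : G →* G') (hφ : Function.Surjective φ) (e : V ≃ₗ[k] V')
    (he : ∀ g v, e (ρ g v) = ρ' (φ g) (e v)) : ρ.IsIrreducible ↔ ρ'.IsIrreducible :=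
  isIrreducible_iff_of_twist_equivariant ρ ρ' φ hφ e (fun _ => 1) fun g v => by
    rw [he, Units.val_one, one_smul]

/-- **Pull-back along a SURJECTIVE homomorphism preserves and reflects irreducibility**: for `φ : G →* G'` onto,
`ρ ∘ φ` is irreducible iff `ρ` is (the stable subspaces coincide). [cite: Bump1997, §4.2 (twisting a representation by a character)] -/
theorem isIrreducible_comp_iff_of_surjective (ρ : Representation k G' V) (φ : G →* G')
    (hφ : Function.Surjective φ) :
    Representation.IsIrreducible (V := V) ((ρ : G' →* (V →ₗ[k] V)).comp φ) ↔ ρ.IsIrreducible :=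
  isIrreducible_iff_of_equivariant (V := V) ((ρ : G' →* (V →ₗ[k] V)).comp φ) ρ φ hφ (LinearEquiv.refl k V)
    fun _ _ => rfl

/-- An irreducible representation stays irreducible when pulled back along a surjective homomorphism (e.g. a
group isomorphism `G ≃* G'`). [cite: Bump1997, §4.2 (twisting a representation by a character)] -/
theorem IsIrreducible.comp_of_surjective {ρ : Representation k G' V} (h : ρ.IsIrreducible) (φ : G →* G')
    (hφ : Function.Surjective φ) :
    Representation.IsIrreducible (V := V) ((ρ : G' →* (V →ₗ[k] V)).comp φ) :=
  (isIrreducible_comp_iff_of_surjective ρ φ hφ).2 h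

/-- **Two actions of one group on one space that differ by unit scalars are irreducible together**:
`ρ g = c g • ρ' g` for all `g` ⟹ (`ρ` irreducible ↔ `ρ'` irreducible). [cite: Bump1997, §4.2 (twisting a representation by a character)] -/
theorem isIrreducible_iff_of_forall_eq_units_smul (ρ ρ' : Representation k G V) (c : G → kˣ)
    (h : ∀ g v, ρ g v = (c g : k) • ρ' g v) : ρ.IsIrreducible ↔ ρ'.IsIrreducible :=
  isIrreducible_iff_of_twist_equivariant ρ ρ' (MonoidHom.id G) Function.surjective_id (LinearEquiv.refl k V) c
    fun g v => h g v

end Representation
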